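import Summits.ResolutionOfSingularities.ResolutionOfSingularities.Theorems.FrobeniusLadderFInjectiveMacaulayficationP2d4F5Specimen
import Summits.ResolutionOfSingularities.ResolutionOfSingularities.Theorems.FrobeniusLadderFInjectiveMacaulayficationStrictTransformChartN
import Summits.ResolutionOfSingularities.ResolutionOfSingularities.Theorems.FrobeniusLadderFInjectiveMacaulayficationPrimeTransfer
import Summits.ResolutionOfSingularities.ResolutionOfSingularities.Theorems.FrobeniusLadderFInjectiveMacaulayficationHypersurfaceOriginNotFull
import HarnessLib

/-!
# NEG-N, FLOOR 1 (chart step and the bad half of the locus lemma): `U₁ = Spec k[x,y,u,t,z]/(g₁)`, `g₁ = z² + x⁵z + x(y³+u³+t³)`;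
# the `x`-chart of `Bl_𝔪 U₁` is `U₂ = Spec k[X]/(g₂)`, `g₂ = z² + x⁴z + x²(y³+u³+t³)`; the origin of `U₁` is NOT FULL
# (crux `FInjectiveMacaulayfication` stmt-ResolutionOfSingularities-15315, chain w45a; res-L1-w45a-plan-1 g19 RULING R19.21 «NEG-N: an unconditional kernel
# refutation of `Recipes.NonFullTowerConjecture` on the period-one bed d4lx6c3», floors NEG-1/3/5 → stub-1 (split proposed l.≈81650); floor table =
# res-L1-w45a-tri-2 g16's replay l.81567 (`k = 1: g₁, I₁ = (t,u,x²,y,z), S₁ = 𝔪, Bl 𝔪 @x`); seat res-L1-w45a-stub-1 g11; pattern = res-L1-w45a-stub-3's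
# `Lx6q7PointFloorCharts` (p639147) restricted to the ONE chart on the loop's path)

[OURS · L1 W4.5a] Support file (`--supports stmt-ResolutionOfSingularities-15315 --as helper`); replaces the role of NO printed item; NOT a statement of any
manuscript; def-free (the floor polynomials are hypotheses `g₁ g₂` with their defining equations); UNCONDITIONAL. §1–§2 over ANY field; §3 `CharP k 2`.
AI-written (AI review is weaker than expert review).

`X 0 = x`, `X 1 = y`, `X 2 = u`, `X 3 = t`, `X 4 = z`.
* §1 ★ `theta_x` — the chart identity `g₁(x, xy, xu, xt, xz) = x²·g₂` (`ring`); `prime_g₁` (Eisenstein-type at `(x,y,u,t) = (0,1,0,0)`: `T² + C(x⁵)T + C(x(y³+u³+t³))`,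
  `∂/∂x (x(y³+u³+t³)) = 1` there — ANY field); `g₁_not_mem_span_X0`, `g₂_not_mem_span_X0` (evaluate at `e_z`), `prime_g₂` (prime transfer along `θ_x`,
  `PrimeTransfer.stub_primeTransfer`), `g₁_ne_zero`, `g₂_ne_zero`;
* §2 ★★ `exists_chartEquiv_x` — `k[X]/(g₂) ≃+*` the Rees chart `D(x̄t)` of `Bl_𝔪 U₁` (`𝔪 = (x̄,ȳ,ū,t̄,z̄)` the origin of `U₁`), sending `x̄ ↦ x̄/1`
  (`StrictTransformChartN.stub_strictTransformChartN`): THE FLOOR-1 → FLOOR-2 LINK of the N-tower (U₂ is an open of `Bl_{S₁} U₁`, `S₁ = 𝔪`);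
  `cmCl_localization_g₁` / `cmCl_localization_g₂` (hypersurfaces are CM);
* §3 ★★ `g₁_mem_bracket` (`g₁ = z·z + x²·x³z + y²·xy + u²·xu + t²·xt ∈ 𝔪^{[2]}`), `constantCoeff_g₁`, `isMaximal_origin`, ★★ `origin_not_fullCl` —
  THE ORIGIN OF `U₁` IS NOT FULL (Fedder necessity, p603303 `HypersurfaceOriginNotFull.not_fullCl_stalk_origin_of_fedder_mem`): the «⊇» half of the floor-1 locus
  lemma «nonFull(U₁) = V(𝔪)»; the «⊆» half (FULL at every other point: parity-class root coefficients `z | x² | y | u | t`) is the sequel file.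
[cite: GortzWedhorn2020, (13.19)] [cite: Fedder1983, Prop. 1.7] [cite: Matsumura1987, Thm. 17.4]
-/

-- single-problem summit: the doubled namespace component is forced
set_option linter.dupNamespace false

noncomputable section

open AlgebraicGeometry CategoryTheory Literature.AlgebraicGeometry.Resolution TopologicalSpace IsLocalRing MvPolynomial

namespace Summit.ResolutionOfSingularities.ResolutionOfSingularities.Theorems.FInjectiveMacaulayfication.NonFullLoopFloorOne

open Summit.ResolutionOfSingularities.ResolutionOfSingularities.Theorems.FInjectiveMacaulayfication
open SliceableCentre GermForm GermOfGlobalBlowup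

variable (k : Type) [Field k]

/-! ## §1 The chart identity, primality -/

/-- ★ **THE CHART IDENTITY OF FLOOR 1**: `g₁(x, xy, xu, xt, xz) = x²·g₂` — the `x`-chart of the blow-up of `U₁` at its origin has strict transform `g₂`. [folklore] -/
theorem theta_x (g₁ : MvPolynomial (Fin 5) k) (hg₁ : g₁ = X 4 ^ 2 + X 0 ^ 5 * X 4 + X 0 * X 1 ^ 3 + X 0 * X 2 ^ 3 + X 0 * X 3 ^ 3)
    (g₂ : MvPolynomial (Fin 5) k) (hg₂ : g₂ = X 4 ^ 2 + X 0 ^ 4 * X 4 + X 0 ^ 2 * X 1 ^ 3 + X 0 ^ 2 * X 2 ^ 3 + X 0 ^ 2 * X 3 ^ 3) :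
    aeval (fun j : Fin 5 => if j = 0 then (X 0 : MvPolynomial (Fin 5) k) else X j * X 0) g₁ = X 0 ^ 2 * g₂ := by
  subst hg₁; subst hg₂
  simp
  ring

/-- **`g₁` is PRIME over any field**: as `T² + C(x⁵)T + C(x(y³+u³+t³))` over `k[x,y,u,t]`, Eisenstein-type at `(0,1,0,0)` (`∂/∂x` of the constant term is
`y³+u³+t³ = 1` there). [folklore; `irreducible_X_pow_add_C_mul_X_add_C`] -/
theorem prime_g₁ (g₁ : MvPolynomial (Fin 5) k) (hg₁ : g₁ = X 4 ^ 2 + X 0 ^ 5 * X 4 + X 0 * X 1 ^ 3 + X 0 * X 2 ^ 3 + X 0 * X 3 ^ 3) : Prime g₁ := by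
  set e : MvPolynomial (Fin 5) k ≃+* Polynomial (MvPolynomial (Fin 4) k) :=
    ((renameEquiv k (_root_.finRotate 5)).trans (finSuccEquiv k 4)).toRingEquiv with he_def
  have hrot4 : (_root_.finRotate 5) (4 : Fin 5) = 0 := by decide
  have hrot : ∀ j : Fin 4, (_root_.finRotate 5) (Fin.castSucc j) = j.succ := by decide
  have he4 : e (X 4) = Polynomial.X := by
    show finSuccEquiv k 4 (rename _ (X 4)) = _
    rw [rename_X, hrot4]; exact finSuccEquiv_X_zero
  have hej : ∀ j : Fin 4, e (X (Fin.castSucc j)) = Polynomial.C (X j) := fun j => by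
    show finSuccEquiv k 4 (rename _ (X (Fin.castSucc j))) = _
    rw [rename_X, hrot j]; exact finSuccEquiv_X_succ (j := j)
  set b : MvPolynomial (Fin 4) k := X 0 ^ 5 with hb
  set c : MvPolynomial (Fin 4) k := X 0 * X 1 ^ 3 + X 0 * X 2 ^ 3 + X 0 * X 3 ^ 3 with hc
  have hef : e g₁ = Polynomial.X ^ 2 + Polynomial.C b * Polynomial.X + Polynomial.C c := by
    rw [hg₁, map_add, map_add, map_add, map_add, map_pow, map_mul, map_pow, he4, map_mul, map_mul, map_mul, map_pow, map_pow, map_pow,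
      show (0 : Fin 5) = Fin.castSucc (0 : Fin 4) from rfl, show (1 : Fin 5) = Fin.castSucc (1 : Fin 4) from rfl,
      show (2 : Fin 5) = Fin.castSucc (2 : Fin 4) from rfl, show (3 : Fin 5) = Fin.castSucc (3 : Fin 4) from rfl, hej, hej, hej, hej, hb, hc]
    simp only [map_add, map_mul, map_pow]
    ring
  set a : Fin 4 → k := ![0, 1, 0, 0] with ha
  have hba : MvPolynomial.eval a b = 0 := by rw [hb, map_pow, eval_X, ha]; simp
  have hca : MvPolynomial.eval a c = 0 := by
    rw [hc]
    simp only [map_add, map_mul, map_pow, eval_X, ha, Matrix.cons_val_zero]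
    simp
  have hder : MvPolynomial.eval a (pderiv 0 c) ≠ 0 := by
    have e1 : pderiv 0 c = X 1 ^ 3 + X 2 ^ 3 + X 3 ^ 3 := by
      rw [hc]
      simp only [map_add, Derivation.leibniz, pderiv_X_self, pderiv_pow, pderiv_X_of_ne (show (1 : Fin 4) ≠ 0 by decide),
        pderiv_X_of_ne (show (2 : Fin 4) ≠ 0 by decide), pderiv_X_of_ne (show (3 : Fin 4) ≠ 0 by decide), smul_eq_mul, mul_zero]
      ring
    rw [e1]
    simp only [map_add, map_pow, eval_X, ha, Matrix.cons_val_one, Matrix.cons_val_zero]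
    simp
  have hirr : Irreducible (e g₁) := by
    rw [hef]
    exact Literature.AlgebraicGeometry.Motives.SmoothHypersurface.irreducible_X_pow_add_C_mul_X_add_C (d := 2) le_rfl b c a hba hca 0 hder
  exact (MulEquiv.prime_iff e).mp hirr.prime

/-- `g₁ ∉ (x)`: at `e_z` (`z = 1`, others `0`) `g₁ = 1`. [folklore] -/
theorem g₁_not_mem_span_X0 (g₁ : MvPolynomial (Fin 5) k) (hg₁ : g₁ = X 4 ^ 2 + X 0 ^ 5 * X 4 + X 0 * X 1 ^ 3 + X 0 * X 2 ^ 3 + X 0 * X 3 ^ 3) :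
    g₁ ∉ Ideal.span {(X 0 : MvPolynomial (Fin 5) k)} := by
  intro h
  rw [Ideal.mem_span_singleton] at h
  obtain ⟨c, hc⟩ := h
  have := congrArg (MvPolynomial.eval (Pi.single 4 1 : Fin 5 → k)) hc
  rw [hg₁] at this
  simp at this

/-- `g₂ ∉ (x)`: at `e_z` `g₂ = 1`. [folklore] -/
theorem g₂_not_mem_span_X0 (g₂ : MvPolynomial (Fin 5) k) (hg₂ : g₂ = X 4 ^ 2 + X 0 ^ 4 * X 4 + X 0 ^ 2 * X 1 ^ 3 + X 0 ^ 2 * X 2 ^ 3 + X 0 ^ 2 * X 3 ^ 3) :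
    g₂ ∉ Ideal.span {(X 0 : MvPolynomial (Fin 5) k)} := by
  intro h
  rw [Ideal.mem_span_singleton] at h
  obtain ⟨c, hc⟩ := h
  have := congrArg (MvPolynomial.eval (Pi.single 4 1 : Fin 5 → k)) hc
  rw [hg₂] at this
  simp at this

/-- `g₁ ≠ 0`, `g₂ ≠ 0`. [plumbing] -/
theorem g_ne_zero (g₁ : MvPolynomial (Fin 5) k) (hg₁ : g₁ = X 4 ^ 2 + X 0 ^ 5 * X 4 + X 0 * X 1 ^ 3 + X 0 * X 2 ^ 3 + X 0 * X 3 ^ 3)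
    (g₂ : MvPolynomial (Fin 5) k) (hg₂ : g₂ = X 4 ^ 2 + X 0 ^ 4 * X 4 + X 0 ^ 2 * X 1 ^ 3 + X 0 ^ 2 * X 2 ^ 3 + X 0 ^ 2 * X 3 ^ 3) : g₁ ≠ 0 ∧ g₂ ≠ 0 :=
  ⟨fun h => g₁_not_mem_span_X0 k g₁ hg₁ (h ▸ Ideal.zero_mem _), fun h => g₂_not_mem_span_X0 k g₂ hg₂ (h ▸ Ideal.zero_mem _)⟩

/-- **`(g₂)` is prime** (prime transfer along `θ_x` from `(g₁)`). [folklore; `PrimeTransfer.stub_primeTransfer`] -/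
theorem isPrime_span_g₂ (g₁ : MvPolynomial (Fin 5) k) (hg₁ : g₁ = X 4 ^ 2 + X 0 ^ 5 * X 4 + X 0 * X 1 ^ 3 + X 0 * X 2 ^ 3 + X 0 * X 3 ^ 3)
    (g₂ : MvPolynomial (Fin 5) k) (hg₂ : g₂ = X 4 ^ 2 + X 0 ^ 4 * X 4 + X 0 ^ 2 * X 1 ^ 3 + X 0 ^ 2 * X 2 ^ 3 + X 0 ^ 2 * X 3 ^ 3) :
    (Ideal.span {g₁}).IsPrime ∧ (Ideal.span {g₂}).IsPrime := by
  have h1 : (Ideal.span {g₁}).IsPrime := (Ideal.span_singleton_prime (prime_g₁ k g₁ hg₁).ne_zero).mpr (prime_g₁ k g₁ hg₁)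
  exact ⟨h1, (PrimeTransfer.stub_primeTransfer k 5 0 g₁ g₂ 2 (theta_x k g₁ hg₁ g₂ hg₂) (g₁_not_mem_span_X0 k g₁ hg₁) (g₂_not_mem_span_X0 k g₂ hg₂)).mp h1⟩

/-! ## §2 The floor-1 → floor-2 link: `k[X]/(g₂)` is the `x`-chart of `Bl_𝔪 U₁`; CM -/

set_option maxHeartbeats 800000 in
-- chart-ring types are expensive to unify (as in `StrictTransformChartN`)
/-- ★★ **`U₂ = Spec k[X]/(g₂)` IS THE REES CHART `D(x̄t)` OF THE BLOW-UP OF `U₁` AT ITS ORIGIN**: a ring isomorphism onto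
`(A₁[𝔪t])_{(x̄t)}`, `A₁ = k[X]/(g₁)`, `𝔪 = (x̄, ȳ, ū, t̄, z̄)`, sending `x̄ ↦ x̄/1`. [folklore; `StrictTransformChartN.stub_strictTransformChartN`; cite: GortzWedhorn2020, (13.19)] -/
theorem exists_chartEquiv_x (g₁ : MvPolynomial (Fin 5) k) (hg₁ : g₁ = X 4 ^ 2 + X 0 ^ 5 * X 4 + X 0 * X 1 ^ 3 + X 0 * X 2 ^ 3 + X 0 * X 3 ^ 3)
    (g₂ : MvPolynomial (Fin 5) k) (hg₂ : g₂ = X 4 ^ 2 + X 0 ^ 4 * X 4 + X 0 ^ 2 * X 1 ^ 3 + X 0 ^ 2 * X 2 ^ 3 + X 0 ^ 2 * X 3 ^ 3) :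
    ∃ e : (MvPolynomial (Fin 5) k ⧸ Ideal.span {g₂}) ≃+*
        HomogeneousLocalization.Away (reesGrading (Ideal.span (Set.range (fun j : Fin 5 => Ideal.Quotient.mk (Ideal.span {g₁}) (X j)))))
          (reesT ((fun j : Fin 5 => Ideal.Quotient.mk (Ideal.span {g₁}) (X j)) 0) (Ideal.subset_span (Set.mem_range_self 0))),
      e (Ideal.Quotient.mk (Ideal.span {g₂}) (X 0)) =
        reesChartBase ((fun j : Fin 5 => Ideal.Quotient.mk (Ideal.span {g₁}) (X j)) 0) (Ideal.subset_span (Set.mem_range_self 0))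
          ((fun j : Fin 5 => Ideal.Quotient.mk (Ideal.span {g₁}) (X j)) 0) := by
  obtain ⟨h1, h2⟩ := isPrime_span_g₂ k g₁ hg₁ g₂ hg₂
  exact StrictTransformChartN.stub_strictTransformChartN k 5 g₁ g₂ 0 2 h1 (g_ne_zero k g₁ hg₁ g₂ hg₂).1 h2
    (PrimeTransfer.X_not_mem_span_of_isPrime h2 (g₂_not_mem_span_X0 k g₂ hg₂)) (theta_x k g₁ hg₁ g₂ hg₂) _ rfl

/-- The CM clause at every prime of `U₁` and of `U₂` (hypersurfaces in a regular ring). [cite: Matsumura1987, Thm. 17.4 (iii), Thm. 17.8] -/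
theorem cmCl_localization (g₁ : MvPolynomial (Fin 5) k) (hg₁ : g₁ = X 4 ^ 2 + X 0 ^ 5 * X 4 + X 0 * X 1 ^ 3 + X 0 * X 2 ^ 3 + X 0 * X 3 ^ 3)
    (g₂ : MvPolynomial (Fin 5) k) (hg₂ : g₂ = X 4 ^ 2 + X 0 ^ 4 * X 4 + X 0 ^ 2 * X 1 ^ 3 + X 0 ^ 2 * X 2 ^ 3 + X 0 ^ 2 * X 3 ^ 3) :
    (∀ Q : Spec (.of (MvPolynomial (Fin 5) k ⧸ Ideal.span {g₁})), CMCl (Localization.AtPrime Q.asIdeal)) ∧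
    (∀ Q : Spec (.of (MvPolynomial (Fin 5) k ⧸ Ideal.span {g₂})), CMCl (Localization.AtPrime Q.asIdeal)) :=
  ⟨fun Q => DoublePointFermatCubicGerm.cmCl_localization_hypersurface k g₁ (g_ne_zero k g₁ hg₁ g₂ hg₂).1 Q,
    fun Q => DoublePointFermatCubicGerm.cmCl_localization_hypersurface k g₂ (g_ne_zero k g₁ hg₁ g₂ hg₂).2 Q⟩

/-! ## §3 The origin of `U₁` is NOT FULL (the «⊇» half of the floor-1 locus lemma) -/

/-- ★★ `g₁ ∈ 𝔪^{[2]} = (x², y², u², t², z²)`: `g₁ = z·z + x²·x³z + y²·xy + u²·xu + t²·xt`. [certificate; cite: Fedder1983, Prop. 1.7] -/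
theorem g₁_mem_bracket (g₁ : MvPolynomial (Fin 5) k) (hg₁ : g₁ = X 4 ^ 2 + X 0 ^ 5 * X 4 + X 0 * X 1 ^ 3 + X 0 * X 2 ^ 3 + X 0 * X 3 ^ 3) :
    g₁ ^ (2 - 1) ∈ Ideal.span (Set.range fun i : Fin 5 => (X i : MvPolynomial (Fin 5) k) ^ 2) := by
  rw [show (2 - 1 : ℕ) = 1 from rfl, pow_one, hg₁]
  have hsq : ∀ j : Fin 5, (X j : MvPolynomial (Fin 5) k) ^ 2 ∈ Ideal.span (Set.range fun i : Fin 5 => (X i : MvPolynomial (Fin 5) k) ^ 2) :=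
    fun j => Ideal.subset_span ⟨j, rfl⟩
  refine Ideal.add_mem _ (Ideal.add_mem _ (Ideal.add_mem _ (Ideal.add_mem _ (hsq 4) ?_) ?_) ?_) ?_
  · rw [show (X 0 : MvPolynomial (Fin 5) k) ^ 5 * X 4 = X 0 ^ 2 * (X 0 ^ 3 * X 4) by ring]
    exact Ideal.mul_mem_right _ _ (hsq 0)
  · rw [show (X 0 : MvPolynomial (Fin 5) k) * X 1 ^ 3 = X 1 ^ 2 * (X 0 * X 1) by ring]
    exact Ideal.mul_mem_right _ _ (hsq 1)
  · rw [show (X 0 : MvPolynomial (Fin 5) k) * X 2 ^ 3 = X 2 ^ 2 * (X 0 * X 2) by ring]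
    exact Ideal.mul_mem_right _ _ (hsq 2)
  · rw [show (X 0 : MvPolynomial (Fin 5) k) * X 3 ^ 3 = X 3 ^ 2 * (X 0 * X 3) by ring]
    exact Ideal.mul_mem_right _ _ (hsq 3)

/-- `g₁` has no constant term. [plumbing] -/
theorem constantCoeff_g₁ (g₁ : MvPolynomial (Fin 5) k) (hg₁ : g₁ = X 4 ^ 2 + X 0 ^ 5 * X 4 + X 0 * X 1 ^ 3 + X 0 * X 2 ^ 3 + X 0 * X 3 ^ 3) :
    constantCoeff g₁ = 0 := by
  rw [hg₁]; simp [constantCoeff_X]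

/-- The origin `(x̄, ȳ, ū, t̄, z̄)` of `U₁` is a maximal ideal. [folklore] -/
theorem isMaximal_origin (g₁ : MvPolynomial (Fin 5) k) (hg₁ : g₁ = X 4 ^ 2 + X 0 ^ 5 * X 4 + X 0 * X 1 ^ 3 + X 0 * X 2 ^ 3 + X 0 * X 3 ^ 3) :
    (Ideal.span (Set.range fun j : Fin 5 => Ideal.Quotient.mk (Ideal.span {g₁}) (X j))).IsMaximal :=
  DoublePointFermatCubicGerm.isMaximal_origin k g₁ (constantCoeff_g₁ k g₁ hg₁)

/-- ★★ **THE ORIGIN OF `U₁` IS NOT FULL** (stalk form): Fedder necessity `g₁ ∈ 𝔪^{[2]}`. [OURS · certificate; cite: Fedder1983, Prop. 1.7] -/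
theorem origin_not_fullCl [CharP k 2] (g₁ : MvPolynomial (Fin 5) k) (hg₁ : g₁ = X 4 ^ 2 + X 0 ^ 5 * X 4 + X 0 * X 1 ^ 3 + X 0 * X 2 ^ 3 + X 0 * X 3 ^ 3)
    (v : Spec (.of (MvPolynomial (Fin 5) k ⧸ Ideal.span {g₁})))
    (hv : v.asIdeal = Ideal.span (Set.range fun j : Fin 5 => Ideal.Quotient.mk (Ideal.span {g₁}) (X j))) :
    ¬ FullCl 2 ((Spec (.of (MvPolynomial (Fin 5) k ⧸ Ideal.span {g₁}))).presheaf.stalk v) := by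
  haveI : Fact (Nat.Prime 2) := ⟨Nat.prime_two⟩
  exact HypersurfaceOriginNotFull.not_fullCl_stalk_origin_of_fedder_mem 2 k g₁ (fun h => g₁_not_mem_span_X0 k g₁ hg₁ (h ▸ Ideal.zero_mem _))
    (constantCoeff_g₁ k g₁ hg₁) (g₁_mem_bracket k g₁ hg₁) v hv

/-- ★★ **THE ORIGIN OF `U₁` IS NOT FULL** (localization form). [OURS · certificate] -/
theorem origin_not_fullCl_localization [CharP k 2] (g₁ : MvPolynomial (Fin 5) k) (hg₁ : g₁ = X 4 ^ 2 + X 0 ^ 5 * X 4 + X 0 * X 1 ^ 3 + X 0 * X 2 ^ 3 + X 0 * X 3 ^ 3)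
    (P : Ideal (MvPolynomial (Fin 5) k ⧸ Ideal.span {g₁})) [hP : P.IsPrime]
    (hPv : P = Ideal.span (Set.range fun j : Fin 5 => Ideal.Quotient.mk (Ideal.span {g₁}) (X j))) : ¬ FullCl 2 (Localization.AtPrime P) := by
  intro hfull
  let v : Spec (.of (MvPolynomial (Fin 5) k ⧸ Ideal.span {g₁})) := ⟨P, hP⟩
  exact origin_not_fullCl k g₁ hg₁ v hPv (WFixAtNonClosedDimTwo.fullCl_of_ringEquiv 2 (Spec.stalkIso (.of _) v).commRingCatIsoToRingEquiv.symm hfull)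

/-- The «⊇» half of the floor-1 locus lemma: every point of `V(𝔪) ⊂ U₁` (i.e. the origin) is NON-FULL. [OURS · certificate] -/
theorem not_fullCl_of_origin_le [CharP k 2] (g₁ : MvPolynomial (Fin 5) k) (hg₁ : g₁ = X 4 ^ 2 + X 0 ^ 5 * X 4 + X 0 * X 1 ^ 3 + X 0 * X 2 ^ 3 + X 0 * X 3 ^ 3)
    (s : Spec (.of (MvPolynomial (Fin 5) k ⧸ Ideal.span {g₁})))
    (hs : Ideal.span (Set.range fun j : Fin 5 => Ideal.Quotient.mk (Ideal.span {g₁}) (X j)) ≤ s.asIdeal) :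
    ¬ FullCl 2 ((Spec (.of (MvPolynomial (Fin 5) k ⧸ Ideal.span {g₁}))).presheaf.stalk s) :=
  origin_not_fullCl k g₁ hg₁ s ((isMaximal_origin k g₁ hg₁).eq_of_le s.2.ne_top hs).symm

end Summit.ResolutionOfSingularities.ResolutionOfSingularities.Theorems.FInjectiveMacaulayfication.NonFullLoopFloorOne

end
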